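import Summits.KontsevichZagierPeriods.KontsevichZagierPeriods.Theorems.LinRedNormalFormArrangementNormalFormSeparateAllHHChart

/-!
# Covering a punctured neighbourhood by nested thin sectors with adapted frames

(Line `janus-bands`, crux `ArrangementNormalForm`, stub `stub_separateHigh_hH`, part `AllHHCover` of
the dimension-generic wall-invariant termwise-split lemma, base dimension `b + 1 ≥ 4` with fibres;
namespace `SepAll`.)
The globalisation step of the local analysis at a base point of `ℝ^r`, in ONE induction on the
depth (no frame planes, no slopes): given ANY assignment `Sc` of positive scales to frames, finitely
many nested sectors `{npt F w | w ∈ hbox Δ}` (part `AllHHChart`; `hbox` = first blown-up coordinate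
in `(0, Δ 0)`, the others in `[0, Δ l)`, so that the axis rays are included) with `Δ ≤ Sc F` cover a
punctured neighbourhood of the origin (`full_cover`, registered as `separateAllHH_cover`). The
frames are built by the RULE: the complement of a direction `d` is a COORDINATE hyperplane
`{x_i = 0}` with `d_i ≠ 0` (embedding `ext i`), preferring `i ≠ β` for a distinguished coordinate
`β`; consequently every frame is linearly independent and contains a non-zero multiple of the
distinguished basis vector `e_β` (the vertical direction `E` of the pole coordinate in the
application). Step: for a unit direction `d` the induction hypothesis in the hyperplane, with the
tail of `Sc` on the extended frames, covers a punctured neighbourhood of `d` in `d + {x_i = 0}`; the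
cone over it is an open cone of directions; the unit sphere is compact.
-/

noncomputable section

open Set Function
open scoped Topology

namespace Summit.KontsevichZagierPeriods.ArrangementNormalForm.JanusBands

namespace SepAll

variable {r : ℕ}

/-! ### Half-open boxes and coordinate embeddings -/

/-- The half-open box: first coordinate in `(0, δ 0)`, the others in `[0, δ l)`. -/
def hbox (δ : Fin r → ℝ) : Set (Fin r → ℝ) :=
  {w | ∀ l : Fin r, ((l : ℕ) = 0 → 0 < w l) ∧ 0 ≤ w l ∧ w l < δ l}

/-- The open box lies in the half-open box. -/
theorem box_subset_hbox (δ : Fin r → ℝ) : box δ ⊆ hbox δ := fun _ hw l =>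
  ⟨fun _ => (mem_box.1 hw l).1, (mem_box.1 hw l).1.le, (mem_box.1 hw l).2⟩

/-- The coordinate embedding `ℝ^r → ℝ^{r+1}` inserting a zero `i`-th coordinate. -/
def ext (i : Fin (r + 1)) : (Fin r → ℝ) →ₗ[ℝ] (Fin (r + 1) → ℝ) where
  toFun y := i.insertNth (0 : ℝ) y
  map_add' y y' := by
    funext j
    refine Fin.succAboveCases i ?_ (fun k => ?_) j <;> simp
  map_smul' c y := by
    funext j
    refine Fin.succAboveCases i ?_ (fun k => ?_) j <;> simp

/-- The embedding in coordinates: the inserted coordinate. -/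
@[simp] theorem ext_apply_same (i : Fin (r + 1)) (y : Fin r → ℝ) : ext i y i = 0 := by
  simp [ext]

/-- The embedding in coordinates: the other coordinates. -/
@[simp] theorem ext_apply_succAbove (i : Fin (r + 1)) (y : Fin r → ℝ) (k : Fin r) :
    ext i y (i.succAbove k) = y k := by
  simp [ext]

/-- The embedding is injective. -/
theorem ker_ext (i : Fin (r + 1)) : LinearMap.ker (ext i) = ⊥ := by
  refine LinearMap.ker_eq_bot.2 fun y y' h => ?_
  funext k
  have := congrFun h (i.succAbove k)
  simpa using this

/-- A vector with vanishing `i`-th coordinate is in the range of the embedding. -/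
theorem ext_removeNth {i : Fin (r + 1)} {y : Fin (r + 1) → ℝ} (hy : y i = 0) :
    ext i (i.removeNth y) = y := by
  have := Fin.insertNth_self_removeNth i y
  rw [hy] at this
  exact this

/-- The embedding of a coordinate vector is a coordinate vector. -/
theorem ext_single (i : Fin (r + 1)) (k : Fin r) (c : ℝ) :
    ext i (Pi.single k c) = Pi.single (i.succAbove k) c := by
  funext j
  refine Fin.succAboveCases i ?_ (fun k' => ?_) j
  · rw [ext_apply_same, Pi.single_eq_of_ne (Fin.ne_succAbove i k)]
  · rw [ext_apply_succAbove]
    by_cases h : k' = k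
    · subst h; simp
    · rw [Pi.single_eq_of_ne h, Pi.single_eq_of_ne]
      exact fun hh => h (Fin.succAbove_right_injective hh)

/-- Embedded nested points. -/
theorem ext_npt (i : Fin (r + 1)) (f : Fin r → Fin r → ℝ) (w : Fin r → ℝ) :
    ext i (npt f w) = npt (fun l => ext i (f l)) w :=
  map_npt (ext i) f w

/-! ### Frames extended by a direction -/

/-- Extending an independent frame of the hyperplane `{x_i = 0}` by a direction with `d_i ≠ 0`. -/
theorem linearIndependent_cons_ext {i : Fin (r + 1)} {d : Fin (r + 1) → ℝ} (hd : d i ≠ 0)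
    {f : Fin r → Fin r → ℝ} (hf : LinearIndependent ℝ f) :
    LinearIndependent ℝ (Fin.cons d (fun l => ext i (f l)) : Fin (r + 1) → Fin (r + 1) → ℝ) := by
  rw [linearIndependent_finCons]
  refine ⟨hf.map' (ext i) (ker_ext i), fun hmem => hd ?_⟩
  have hle : Submodule.span ℝ (range fun l => ext i (f l)) ≤
      LinearMap.ker (LinearMap.proj i : (Fin (r + 1) → ℝ) →ₗ[ℝ] ℝ) := by
    refine Submodule.span_le.2 ?_
    rintro _ ⟨l, rfl⟩
    simp
  have := hle hmem
  simpa using this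

/-! ### The cover -/

/-- **Covering a punctured neighbourhood of the origin by finitely many nested sectors with
adapted frames, any depth.** See the module docstring. -/
theorem full_cover (r : ℕ) : ∀ (β : Option (Fin r)) (Sc : (Fin r → Fin r → ℝ) → Fin r → ℝ),
    (∀ f l, 0 < Sc f l) →
    ∃ (ι : Type) (_ : Fintype ι) (_ : Nonempty ι) (F : ι → Fin r → Fin r → ℝ) (Δ : ι → Fin r → ℝ),
      (∀ m, LinearIndependent ℝ (F m)) ∧
      (∀ j, β = some j → ∀ m, ∃ (l : Fin r) (c : ℝ), c ≠ 0 ∧ F m l = c • Pi.single j 1) ∧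
      (∀ m l, 0 < Δ m l ∧ Δ m l ≤ Sc (F m) l) ∧
      ∃ ρ : ℝ, 0 < ρ ∧ ∀ x : Fin r → ℝ, x ≠ 0 → ‖x‖ < ρ →
        ∃ m, ∃ w ∈ hbox (Δ m), x = npt (F m) w := by
  induction r with
  | zero =>
    intro β Sc _
    refine ⟨Unit, inferInstance, inferInstance, fun _ l => l.elim0, fun _ l => l.elim0,
      fun _ => linearIndependent_empty_type, fun j => j.elim0, fun _ l => l.elim0,
      1, one_pos, fun x hx _ => ?_⟩
    exact absurd (Subsingleton.elim x 0) hx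
  | succ r ih =>
    intro β Sc hSc
    classical
    -- the unit sphere of the sup norm
    set S : Set (Fin (r + 1) → ℝ) := Metric.sphere 0 1 with hS
    have hS0 : ∀ d : S, (d : Fin (r + 1) → ℝ) ≠ 0 := fun d h => by
      have h1 : ‖(d : Fin (r + 1) → ℝ)‖ = 1 := mem_sphere_zero_iff_norm.1 d.2
      rw [h, norm_zero] at h1
      exact zero_ne_one h1
    -- the complement rule: a coordinate `i` with `d i ≠ 0`, preferably off `β`
    have hex : ∀ d : S, ∃ i : Fin (r + 1), (d : Fin (r + 1) → ℝ) i ≠ 0 ∧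
        ((∃ i', β ≠ some i' ∧ (d : Fin (r + 1) → ℝ) i' ≠ 0) → β ≠ some i) := by
      intro d
      by_cases h : ∃ i', β ≠ some i' ∧ (d : Fin (r + 1) → ℝ) i' ≠ 0
      · obtain ⟨i', h1, h2⟩ := h
        exact ⟨i', h2, fun _ => h1⟩
      · obtain ⟨i, hi⟩ := Function.ne_iff.1 (hS0 d)
        exact ⟨i, hi, fun h' => absurd h' h⟩
    choose idx hidx hpref using hex
    -- the distinguished coordinate in the hyperplane
    have hβ' : ∀ d : S, ∃ β' : Option (Fin r), ∀ j, β = some j → j ≠ idx d →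
        ∃ j', β' = some j' ∧ (idx d).succAbove j' = j := by
      intro d
      rcases hβ : β with _ | j
      · exact ⟨none, fun j hj => by cases hj⟩
      · by_cases hji : j = idx d
        · exact ⟨none, fun j₁ hj₁ hne => by cases hj₁; exact absurd hji hne⟩
        · obtain ⟨j', hj'⟩ := Fin.exists_succAbove_eq hji
          exact ⟨some j', fun j₁ hj₁ _ => by cases hj₁; exact ⟨j', rfl, hj'⟩⟩
    choose β' hβ' using hβ'
    -- the inner covers
    set Fd : ∀ d : S, (Fin r → Fin r → ℝ) → Fin (r + 1) → Fin (r + 1) → ℝ :=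
      fun d f' => Fin.cons (d : Fin (r + 1) → ℝ) (fun l => ext (idx d) (f' l)) with hFd
    have hSc' : ∀ d : S, ∀ (f' : Fin r → Fin r → ℝ) (l : Fin r), 0 < Fin.tail (Sc (Fd d f')) l :=
      fun d f' l => hSc _ _
    choose ιd fιd nιd F' Δ' hli' hE' hΔ' ρd hρd hcov' using
      fun d : S => ih (β' d) (fun f' => Fin.tail (Sc (Fd d f'))) (hSc' d)
    -- head scales
    have hδ₀ : ∀ d : S, ∃ δ₀ : ℝ, 0 < δ₀ ∧ ∀ m, δ₀ ≤ Sc (Fd d (F' d m)) 0 := by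
      intro d
      haveI := fιd d; haveI := nιd d
      obtain ⟨m₀, hm₀⟩ := Finite.exists_min fun m => Sc (Fd d (F' d m)) 0
      exact ⟨_, hSc _ _, hm₀⟩
    choose δ₀ hδ₀pos hδ₀le using hδ₀
    -- the open cones of directions
    set U : S → Set (Fin (r + 1) → ℝ) := fun d =>
      {x | 0 < x (idx d) / (d : Fin (r + 1) → ℝ) (idx d)} ∩
        ⋂ j, {x | |x j - x (idx d) / (d : Fin (r + 1) → ℝ) (idx d) * (d : Fin (r + 1) → ℝ) j| <
          ρd d * (x (idx d) / (d : Fin (r + 1) → ℝ) (idx d))} with hU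
    have hUo : ∀ d, IsOpen (U d) := by
      intro d
      have hc : Continuous fun x : Fin (r + 1) → ℝ => x (idx d) / (d : Fin (r + 1) → ℝ) (idx d) :=
        (continuous_apply _).div_const _
      refine (isOpen_lt continuous_const hc).inter (isOpen_iInter_of_finite fun j => ?_)
      exact isOpen_lt (((continuous_apply j).sub (hc.mul continuous_const)).abs)
        (continuous_const.mul hc)
    have hdU : ∀ d : S, (d : Fin (r + 1) → ℝ) ∈ U d := by
      intro d
      simp only [hU, mem_inter_iff, mem_setOf_eq, mem_iInter, div_self (hidx d)]
      refine ⟨one_pos, fun j => ?_⟩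
      rw [one_mul, sub_self, abs_zero, mul_one]
      exact hρd d
    have hUcone : ∀ d : S, ∀ x ∈ U d, ∀ c : ℝ, 0 < c → c • x ∈ U d := by
      intro d x hx c hc
      simp only [hU, mem_inter_iff, mem_setOf_eq, mem_iInter, Pi.smul_apply, smul_eq_mul] at hx ⊢
      obtain ⟨h1, h2⟩ := hx
      refine ⟨by rw [mul_div_assoc]; exact mul_pos hc h1, fun j => ?_⟩
      have := h2 j
      rw [mul_div_assoc, show c * x j - c * (x (idx d) / (d : Fin (r + 1) → ℝ) (idx d)) *
        (d : Fin (r + 1) → ℝ) j = c * (x j - x (idx d) / (d : Fin (r + 1) → ℝ) (idx d) *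
        (d : Fin (r + 1) → ℝ) j) by ring, abs_mul, abs_of_pos hc, ← mul_assoc, mul_comm (ρd d) c,
        mul_assoc]
      exact mul_lt_mul_of_pos_left this hc
    -- compactness of the sphere
    obtain ⟨T, hT⟩ := (isCompact_sphere (0 : Fin (r + 1) → ℝ) 1).elim_finite_subcover
      (fun d : S => U d) hUo (fun u hu => mem_iUnion.2 ⟨⟨u, hu⟩, hdU ⟨u, hu⟩⟩)
    -- the sphere is not empty
    have he : (fun _ : Fin (r + 1) => (1 : ℝ)) ∈ S := by
      show (fun _ : Fin (r + 1) => (1 : ℝ)) ∈ Metric.sphere (0 : Fin (r + 1) → ℝ) 1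
      rw [mem_sphere_zero_iff_norm]
      refine le_antisymm ((pi_norm_le_iff_of_nonneg zero_le_one).2 fun _ => by simp) ?_
      have h1 := norm_le_pi_norm (fun _ : Fin (r + 1) => (1 : ℝ)) 0
      rwa [norm_one] at h1
    obtain ⟨d₀, hd₀T, -⟩ : ∃ d ∈ T, (fun _ : Fin (r + 1) => (1 : ℝ)) ∈ U d := by
      have := hT he
      simpa only [mem_iUnion, exists_prop] using this
    have hTne : T.Nonempty := ⟨d₀, hd₀T⟩
    -- the family
    haveI : ∀ d, Fintype (ιd d) := fιd
    refine ⟨(d : T) × ιd d.1, inferInstance, ⟨⟨⟨d₀, hd₀T⟩, Classical.choice (nιd d₀)⟩⟩,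
      fun p => Fd p.1.1 (F' p.1.1 p.2), fun p => Fin.cons (δ₀ p.1.1) (Δ' p.1.1 p.2),
      fun p => ?_, fun j hj p => ?_, fun p => ?_, ?_⟩
    · -- linear independence
      exact linearIndependent_cons_ext (hidx _) (hli' _ _)
    · -- the distinguished coordinate is hit
      obtain ⟨⟨d, hdT⟩, m⟩ := p
      by_cases hji : j = idx d
      · -- forced: the direction itself is on the distinguished axis
        have hall : ∀ i', i' ≠ j → (d : Fin (r + 1) → ℝ) i' = 0 := by
          intro i' hi'
          by_contra hne
          exact hpref d ⟨i', by rw [hj]; exact fun h => hi' (Option.some_injective _ h).symm, hne⟩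
            (by rw [hj, hji])
        refine ⟨(0 : Fin (r + 1)), (d : Fin (r + 1) → ℝ) j, by rw [hji]; exact hidx d, ?_⟩
        simp only [hFd, Fin.cons_zero]
        funext i'
        by_cases h : i' = j
        · subst h; simp
        · rw [Pi.smul_apply, Pi.single_eq_of_ne h, smul_zero, hall i' h]
      · obtain ⟨j', hβj', hsucc⟩ := hβ' d j hj hji
        obtain ⟨l, c, hc, hl⟩ := hE' d j' hβj' m
        refine ⟨l.succ, c, hc, ?_⟩
        simp only [hFd, Fin.cons_succ]
        rw [hl, map_smul, ext_single, hsucc]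
    · -- scales
      obtain ⟨⟨d, hdT⟩, m⟩ := p
      refine Fin.cases ?_ (fun l => ?_)
      · dsimp only
        simp only [Fin.cons_zero]
        exact ⟨hδ₀pos d, hδ₀le d m⟩
      · dsimp only
        simp only [Fin.cons_succ]
        exact hΔ' d m l
    · -- the covering
      set ρ : ℝ := T.inf' hTne fun d => δ₀ d * |(d : Fin (r + 1) → ℝ) (idx d)| with hρ
      have hρle : ∀ d ∈ T, ρ ≤ δ₀ d * |(d : Fin (r + 1) → ℝ) (idx d)| := fun d hd =>
        Finset.inf'_le _ hd
      have hρpos : 0 < ρ := by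
        obtain ⟨d, -, hd⟩ := Finset.exists_mem_eq_inf' hTne fun d => δ₀ d * |(d : Fin (r + 1) → ℝ) (idx d)|
        rw [hρ, hd]
        exact mul_pos (hδ₀pos d) (abs_pos.2 (hidx d))
      refine ⟨ρ, hρpos, fun x hx hxρ => ?_⟩
      -- normalise and locate the direction
      have hxn : 0 < ‖x‖ := norm_pos_iff.2 hx
      have hu : ‖x‖⁻¹ • x ∈ S := by
        show ‖x‖⁻¹ • x ∈ Metric.sphere (0 : Fin (r + 1) → ℝ) 1
        rw [mem_sphere_zero_iff_norm, norm_smul, norm_inv, norm_norm, inv_mul_cancel₀ hxn.ne']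
      obtain ⟨d, hdT, hxd⟩ : ∃ d ∈ T, ‖x‖⁻¹ • x ∈ U d := by
        simpa only [mem_iUnion, exists_prop] using hT hu
      have hxU : x ∈ U d := by
        have := hUcone d _ hxd ‖x‖ hxn
        rwa [smul_smul, mul_inv_cancel₀ hxn.ne', one_smul] at this
      simp only [hU, mem_inter_iff, mem_setOf_eq, mem_iInter] at hxU
      obtain ⟨hτ, hy⟩ := hxU
      set τ : ℝ := x (idx d) / (d : Fin (r + 1) → ℝ) (idx d) with hτdef
      -- the outer coordinate
      have hτlt : τ < δ₀ d := by
        have h1 : |x (idx d)| < ρ := (norm_le_pi_norm x (idx d)).trans_lt hxρ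
        have h2 : ρ ≤ δ₀ d * |(d : Fin (r + 1) → ℝ) (idx d)| := hρle d hdT
        have h3 : τ = |τ| := (abs_of_pos hτ).symm
        rw [h3, hτdef, abs_div, div_lt_iff₀ (abs_pos.2 (hidx d))]
        linarith
      -- the inner point
      set y : Fin (r + 1) → ℝ := τ⁻¹ • x - (d : Fin (r + 1) → ℝ) with hydef
      have hxi : x (idx d) ≠ 0 := fun h => by
        rw [hτdef, h, zero_div] at hτ; exact lt_irrefl _ hτ
      have hyi : y (idx d) = 0 := by
        simp only [hydef, Pi.sub_apply, Pi.smul_apply, smul_eq_mul]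
        rw [hτdef, inv_div, div_mul_cancel₀ _ hxi, sub_self]
      have hysmall : ∀ j, |y j| < ρd d := by
        intro j
        have := hy j
        have e : y j = τ⁻¹ * (x j - τ * (d : Fin (r + 1) → ℝ) j) := by
          simp only [hydef, Pi.sub_apply, Pi.smul_apply, smul_eq_mul]
          field_simp [hτ.ne']
        rw [e, abs_mul, abs_of_pos (inv_pos.2 hτ), inv_mul_lt_iff₀ hτ]
        linarith
      have hxy : x = τ • ((d : Fin (r + 1) → ℝ) + y) := by
        simp only [hydef, add_sub_cancel, smul_smul, mul_inv_cancel₀ hτ.ne', one_smul]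
      set y' : Fin r → ℝ := (idx d).removeNth y with hy'def
      have hyext : ext (idx d) y' = y := ext_removeNth hyi
      by_cases hy0 : y' = 0
      · -- on the axis ray
        obtain ⟨m⟩ := nιd d
        refine ⟨⟨⟨d, hdT⟩, m⟩, Fin.cons τ 0, fun l => ?_, ?_⟩
        · refine Fin.cases ?_ (fun k => ?_) l
          · simp only [Fin.cons_zero, Fin.val_zero]
            exact ⟨fun _ => hτ, hτ.le, hτlt⟩
          · simp only [Fin.cons_succ, Pi.zero_apply]
            exact ⟨fun h => absurd h (Nat.succ_ne_zero _), le_rfl, (hΔ' d m k).1⟩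
        · show x = npt (Fin.cons (d : Fin (r + 1) → ℝ) (fun l => ext (idx d) (F' d m l))) (Fin.cons τ 0)
          rw [npt_cons, npt_zero, hxy, ← hyext, hy0, map_zero]
      · -- in an inner sector
        have hyn : ‖y'‖ < ρd d := by
          rw [pi_norm_lt_iff (hρd d)]
          intro k
          rw [Real.norm_eq_abs, hy'def]
          exact hysmall _
        obtain ⟨m, w', hw', hyw⟩ := hcov' d y' hy0 hyn
        refine ⟨⟨⟨d, hdT⟩, m⟩, Fin.cons τ w', fun l => ?_, ?_⟩
        · refine Fin.cases ?_ (fun k => ?_) l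
          · simp only [Fin.cons_zero, Fin.val_zero]
            exact ⟨fun _ => hτ, hτ.le, hτlt⟩
          · simp only [Fin.cons_succ]
            exact ⟨fun h => absurd h (Nat.succ_ne_zero _), (hw' k).2.1, (hw' k).2.2⟩
        · show x = npt (Fin.cons (d : Fin (r + 1) → ℝ) (fun l => ext (idx d) (F' d m l))) (Fin.cons τ w')
          rw [npt_cons, ← ext_npt, ← hyw, hyext, hxy]

end SepAll

/-- **Covering a punctured neighbourhood of the origin of `ℝ^r` by finitely many nested thin
sectors with adapted frames** (registered part of `stub_separateHigh_hH`; literal form of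
`SepAll.full_cover`): for every assignment of positive scales to frames and every distinguished
coordinate `β`, finitely many nested sectors over half-open boxes within the assigned scales, with
linearly independent frames each containing a non-zero multiple of `e_β`, cover a punctured
neighbourhood of `0`. -/
theorem separateAllHH_cover (r : ℕ) (β : Option (Fin r)) (Sc : (Fin r → Fin r → ℝ) → Fin r → ℝ) (hSc : ∀ f l, 0 < Sc f l) : ∃ (ι : Type) (_ : Fintype ι) (_ : Nonempty ι) (F : ι → Fin r → Fin r → ℝ) (Δ : ι → Fin r → ℝ), (∀ m, LinearIndependent ℝ (F m)) ∧ (∀ j, β = some j → ∀ m, ∃ (l : Fin r) (c : ℝ), c ≠ 0 ∧ F m l = c • Pi.single j 1) ∧ (∀ m l, 0 < Δ m l ∧ Δ m l ≤ Sc (F m) l) ∧ ∃ ρ : ℝ, 0 < ρ ∧ ∀ x : Fin r → ℝ, x ≠ 0 → ‖x‖ < ρ → ∃ m, ∃ w : Fin r → ℝ, (∀ l : Fin r, ((l : ℕ) = 0 → 0 < w l) ∧ 0 ≤ w l ∧ w l < Δ m l) ∧ x = ∑ l, (∏ j, if j ≤ l then w j else 1) • F m l := by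
  obtain ⟨ι, hι, hn, F, Δ, h1, h2, h3, ρ, hρ, h4⟩ := SepAll.full_cover r β Sc hSc
  exact ⟨ι, hι, hn, F, Δ, h1, h2, h3, ρ, hρ, fun x hx hxρ => by
    obtain ⟨m, w, hw, hxw⟩ := h4 x hx hxρ; exact ⟨m, w, hw, hxw⟩⟩

end Summit.KontsevichZagierPeriods.ArrangementNormalForm.JanusBands
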